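import Mathlib.LinearAlgebra.Matrix.Trace
import Mathlib.LinearAlgebra.Matrix.ConjTranspose
import HarnessLib

/-!
# Stationarity (equation-of-motion) rows under a projection constraint — which Hamiltonian a row refers to

Topic `Literature/Computation/Certificates` (joins `SemidefiniteRigorousBounds.lean`,
`LagrangianSplitBound.lean`, `TraceFormBlocks.lean`, `RealFormHermitianBlocks.lean`:
kernel-checkable certificate algebra).

Context. A many-body bootstrap / moment relaxation imposes STATIONARITY rows `ω([H, w]) = 0` for
test words `w`, built from a fixed Hamiltonian `H` [Han2020Bootstrap, §2: the ground state (indeed any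
energy eigenstate / stationary state) satisfies `⟨[H, O]⟩ = 0` for every operator `O`]. When the state
is additionally constrained to the range of a projection `P` — e.g. the no-double-occupancy space of the
`U = ∞` Hubbard model, `P = Π_i (1 - n_{i↑} n_{i↓})`, imposed in a relaxation by the row `ω(n↑ n↓) = 0` —
the dynamics on that range is generated by the COMPRESSED Hamiltonian `P H P`, and the valid stationarity
rows are `ω([P H P, w]) = 0`. The two families of rows AGREE for test words that commute with `P`:

* `ProjectedStationarity.trace_comm_compress_eq` — density-matrix form over any commutative ring:
  `P ρ = ρ`, `ρ P = ρ` (state supported on the range of `P`) and `w P = P w` imply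
  `Tr(ρ (P H P · w − w · P H P)) = Tr(ρ (H w − w H))`;
* `ProjectedStationarity.star_dotProduct_comm_compress_mulVec_eq` — pure-state form over a star ring:
  `Pᴴ = P`, `P ψ = ψ`, `w P = P w` imply `ψ† (P H P · w − w · P H P) ψ = ψ† (H w − w H) ψ`.

So an `H`-built stationarity row survives a projection constraint exactly for `P`-commuting test words
(densities, spin operators, fully projected hoppings in the Hubbard case); for other words
`ω([H, w]) = 0` is NOT implied by `ω([P H P, w]) = 0` (hubbard-alg `L5-lit/METHODS.md` ADDENDUM G19-1.2 (C),
PRECISION (xxii); exact-diagonalisation counterexamples in `L5-lit/evidence-lit2-g19/`).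
No hypothesis `P * P = P` is needed for the identities themselves.
No `Prop` definitions, no named facts; everything is proved.
-/

namespace Literature.Computation.Certificates

open Matrix

namespace ProjectedStationarity

variable {n : Type*} [Fintype n] {R : Type*} [CommRing R]

/-- **Compressed vs. bare stationarity rows, density-matrix form.** If the state `ρ` is supported on
the range of `P` (`P ρ = ρ = ρ P`) and the test word `w` commutes with `P`, the stationarity row built
from the compressed Hamiltonian `P H P` equals the one built from `H`:
`Tr(ρ (P H P w − w P H P)) = Tr(ρ (H w − w H))`.
[cite: Han2020Bootstrap, §2 (stationarity constraints ⟨[H, O]⟩ = 0)] -/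
theorem trace_comm_compress_eq (P H w ρ : Matrix n n R)
    (hPρ : P * ρ = ρ) (hρP : ρ * P = ρ) (hw : w * P = P * w) :
    (ρ * (P * H * P * w - w * (P * H * P))).trace = (ρ * (H * w - w * H)).trace := by
  have e1 : ρ * (P * H * P * w) = ρ * H * w * P := by
    calc ρ * (P * H * P * w) = ρ * P * H * (P * w) := by simp only [Matrix.mul_assoc]
      _ = ρ * H * (w * P) := by rw [hρP, ← hw]
      _ = ρ * H * w * P := by simp only [Matrix.mul_assoc]
  have e2 : ρ * (w * (P * H * P)) = ρ * w * H * P := by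
    calc ρ * (w * (P * H * P)) = ρ * (w * P) * H * P := by simp only [Matrix.mul_assoc]
      _ = ρ * (P * w) * H * P := by rw [hw]
      _ = ρ * P * w * H * P := by simp only [Matrix.mul_assoc]
      _ = ρ * w * H * P := by rw [hρP]
  have a1 : P * (ρ * H * w) = ρ * (H * w) := by
    calc P * (ρ * H * w) = P * ρ * H * w := by simp only [Matrix.mul_assoc]
      _ = ρ * H * w := by rw [hPρ]
      _ = ρ * (H * w) := by simp only [Matrix.mul_assoc]
  have a2 : P * (ρ * w * H) = ρ * (w * H) := by
    calc P * (ρ * w * H) = P * ρ * w * H := by simp only [Matrix.mul_assoc]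
      _ = ρ * w * H := by rw [hPρ]
      _ = ρ * (w * H) := by simp only [Matrix.mul_assoc]
  have t1 : (ρ * H * w * P).trace = (ρ * (H * w)).trace := by
    rw [Matrix.trace_mul_comm (ρ * H * w) P, a1]
  have t2 : (ρ * w * H * P).trace = (ρ * (w * H)).trace := by
    rw [Matrix.trace_mul_comm (ρ * w * H) P, a2]
  rw [Matrix.mul_sub, Matrix.mul_sub, Matrix.trace_sub, Matrix.trace_sub, e1, e2, t1, t2]

/-- **Compressed vs. bare stationarity rows, pure-state form.** For a self-adjoint `P` (`Pᴴ = P`),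
a vector `ψ` in its range (`P ψ = ψ`) and a test word `w` commuting with `P`:
`ψ† (P H P w − w P H P) ψ = ψ† (H w − w H) ψ`.
[cite: Han2020Bootstrap, §2 (stationarity constraints ⟨[H, O]⟩ = 0)] -/
theorem star_dotProduct_comm_compress_mulVec_eq [StarRing R] (P H w : Matrix n n R) (ψ : n → R)
    (hP : Pᴴ = P) (hψ : P *ᵥ ψ = ψ) (hw : w * P = P * w) :
    star ψ ⬝ᵥ (P * H * P * w - w * (P * H * P)) *ᵥ ψ = star ψ ⬝ᵥ (H * w - w * H) *ᵥ ψ := by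
  -- left absorption of `P`: `ψ† P = ψ†`
  have hL : star ψ ᵥ* P = star ψ := by
    conv_rhs => rw [← hψ]
    rw [Matrix.star_mulVec, hP]
  -- `P` acts trivially on `w ψ` because `w` commutes with `P`
  have hR : P *ᵥ (w *ᵥ ψ) = w *ᵥ ψ := by
    rw [Matrix.mulVec_mulVec ψ P w, ← hw, ← Matrix.mulVec_mulVec ψ w P, hψ]
  have key1 : (P * H * P * w) *ᵥ ψ = P *ᵥ ((H * w) *ᵥ ψ) := by
    have h1 : (P * H * P * w) *ᵥ ψ = P *ᵥ (H *ᵥ (P *ᵥ (w *ᵥ ψ))) := by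
      simp only [← Matrix.mulVec_mulVec]
    rw [h1, hR, Matrix.mulVec_mulVec ψ H w]
  have key2 : (w * (P * H * P)) *ᵥ ψ = P *ᵥ ((w * H) *ᵥ ψ) := by
    have h2 : (w * (P * H * P)) *ᵥ ψ = w *ᵥ (P *ᵥ (H *ᵥ (P *ᵥ ψ))) := by
      simp only [← Matrix.mulVec_mulVec]
    rw [h2, hψ, Matrix.mulVec_mulVec (H *ᵥ ψ) w P, hw, ← Matrix.mulVec_mulVec (H *ᵥ ψ) P w,
      Matrix.mulVec_mulVec ψ w H]
  rw [Matrix.sub_mulVec, Matrix.sub_mulVec, dotProduct_sub, dotProduct_sub, key1, key2,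
    Matrix.dotProduct_mulVec (star ψ) P ((H * w) *ᵥ ψ),
    Matrix.dotProduct_mulVec (star ψ) P ((w * H) *ᵥ ψ), hL]

/-- The special case most used in practice: a test word commuting with `P` that is ITSELF evaluated
on a `P`-supported state gives the same EXPECTATION row as well, `Tr(ρ (P w P)) = Tr(ρ w)` — so
`P`-commuting observables and their `H`- vs `PHP`-stationarity rows can be transported verbatim
between the constrained and the unconstrained bookkeeping.
[cite: Han2020Bootstrap, §2 (stationarity constraints ⟨[H, O]⟩ = 0)] -/
theorem trace_compress_eq (P w ρ : Matrix n n R) (hPρ : P * ρ = ρ) (hρP : ρ * P = ρ) :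
    (ρ * (P * w * P)).trace = (ρ * w).trace := by
  have e : ρ * (P * w * P) = ρ * w * P := by
    calc ρ * (P * w * P) = ρ * P * w * P := by simp only [Matrix.mul_assoc]
      _ = ρ * w * P := by rw [hρP]
  rw [e, Matrix.trace_mul_comm (ρ * w) P, ← Matrix.mul_assoc, hPρ]

end ProjectedStationarity

end Literature.Computation.Certificates
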